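/-
Copyright (c) 2026 the pub-hodgecm-mathlib formalisation cell (harness21).  Prover seat hodgecm-mathlib-K2Liu-p12 (g5), Track B «K2-LIT»,
#184♮ = hLiu418 = `stmt-HodgeConjecture-24832`; socket #41 open surface (u-0c), file I4 EDITION 4 (K2E4-p11 (g8), `exists_middleTerm_package_of_standard`),
SECOND HAND (LEAD F0P6-plan (g14) BATCH #65 (2) ∕ #66 (2) «(D2) GO»): the LEVEL LETTERS `S γl hγ0 hγ1 hχlev U hUK hfU hΛU` of that head, PAID.
THEOREMS ONLY (no `def`, no `instance`, no `notation`, no named-fact hypothesis, no `sorry`).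
-/
import Summits.HodgeConjecture.HodgeConjecture.Theorems.K2LiuIwasawaDatumStdSmooth   -- ★ Lemma K-f `exists_isOpen_forall_mul_eq_of_isStd`, ★ `exists_openSubgroup_forall_eq_one`
import Literature.NumberTheory.Automorphic.GLnCongruenceSubgroups                     -- ★ `congruenceGL`, `exists_congruenceGL_subset`, `congruenceGL_mono`
import Literature.NumberTheory.Automorphic.GLnFiniteAdeleRestrictedProduct            -- ★ `GLn.evalAt`, `GLn.integralComponents` (bijective, continuous), `isCompact_glFiniteIntegralLevel_holds`
import HarnessLib

/-!
# Crux `HLiu418`, socket #41, (u-0c) FILE I4 ED. 4 — `K2LiuSiegelMiddleTermLevelLetters`: THE LEVEL LETTERS OF THE MIDDLE-TERM DATUM INSTANTIATION, PAID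

Cell `hodgecm-mathlib`, crux item hLiu418 = `stmt-HodgeConjecture-24832`; squad K2 ∕ K2Liu, road `K2_Liu`, socket #41; LEAD F0P6-plan (g14) BATCH #65 (2), #66 (2)
(RULING M-158j: every letter below is inhabited at the GENERIC instance the socket quantifies over — an arbitrary STANDARD Iwasawa datum `𝒦`, `𝒦.IsStd`).
Lane `--supports stmt-HodgeConjecture-24832 --as helper` (count-neutral helper; closes no socket by itself).  Consumer: K2E4-p11 (g8)'s I4 ED. 4
`K2LiuSiegelEisensteinMiddleTermOfStandard.exists_middleTerm_package_of_standard`, whose head carries BY VALUE the level `S γl (hγ0) (hγ1)`, the conductor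
letter `hχlev` (★ `K2LiuSiegelMiddleTermDetCharacter.ha_lev`'s binder), the stabiliser `U (hUK) (hfU)` (★ p862178 `K2LiuSiegelMiddleTermInnerKTypeOfStandard.exists_KHType_of_standard`'s
binders) and the Levi compatibility `hΛU`.  THIS FILE produces all of them at once from `𝒦.IsStd`, the `𝒦.K`-finiteness and continuity of the section `φ = f s₀`, ANY Hecke
character `χ`, and ANY continuous homomorphism `Λ : GL_n(𝔸_L) →* H(𝔸)` killing the archimedean component of `GL_n(𝔸_L^∞)` (`hΛ1 : (Λ (1, r))_∞ = 1` — true for the chart's Levi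
homomorphism ★ `K2LiuSiegelDoubledLeviMatrix.exists_leviHom`, whose matrix is a polynomial in the entries of `(r, r⁻¹)`; taken BY VALUE here).

THE MATHEMATICS [BorelJacquet1979, §1.1, §4.1], [PlatonovRapinchuk1994, §5.1], [NeukirchANT1999, VII §6 (6.11)], [Tan1999, §1 p. 166].
* §1 `exists_level_subset_of_mem_nhds_one` — THE PRINCIPAL CONGRUENCE LEVELS ARE A NEIGHBOURHOOD BASIS OF `1` IN `GL_n(𝔸_L^∞)` READ ON `GL_n(𝒪̂_L)`: every neighbourhood `W` of `1`
  contains `{r ∈ GL_n(𝒪̂_L) | r_v ∈ K_v(γ_v), v ∈ S}` for a finite `S` and levels `0 ≠ γ_v < 1` (`GL_n(𝒪̂_L) ≃ₜ ∏_v GL_n(𝒪_v)` — ★ `GLn.bijective_integralComponents`, compact to Hausdorff —,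
  a product neighbourhood, and ★ `exists_congruenceGL_subset` at the finitely many constrained places).
* §2 `exists_nhds_one_forall_heckeCharacter_det_eq_one` — THE CONDUCTOR OF `χ ∘ det`: `χ(det (1, r)) = 1` on a neighbourhood of `1` in `GL_n(𝒪̂_L)` (the continuous homomorphism
  `r ↦ χ(det(1, r))` on the compact totally disconnected group `GL_n(𝒪̂_L)` has OPEN kernel: no small subgroups in `ℂ`, ★ `exists_openSubgroup_forall_eq_one`).
* §3 `exists_isOpen_forall_rightTranslateSpan_mul_eq` — LEMMA K-f FOR THE WHOLE `K`-TYPE: one open `U_f ≤ H(𝔸_f)` under which EVERY vector of the span `V` of the right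
  `𝒦.K`-translates of `φ` is right-invariant (★ `exists_isOpen_forall_mul_eq_of_isStd` at a finite spanning set of `V`; `V` is right-`𝒦.K`-stable).
* §4 **`exists_level_letters`** — the four letters: ONE level `(S, γl)` (intersection of §2's neighbourhood with the open preimage `{r | (Λ(1,r))_f ∈ U_f}`, then §1) with
  `hχlev`; `U := {u ∈ H(𝔸) | ∀ c ∈ 𝒦.K, ∀ g, φ(g·c⁻¹uc) = φ(g)}` (a subgroup normalised by `𝒦.K` BY CONSTRUCTION — `hUK`; `hfU` at `c = 1`); and `hΛU`: for `r` in the level and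
  `c ∈ 𝒦.K`, `φ(g c⁻¹ · Λ(1,r) · c) = (R_c φ)((g c⁻¹) · Λ(1,r)) = (R_c φ)(g c⁻¹) = φ(g)` because `R_c φ ∈ V` is `U_f`-invariant (§3) and `(Λ(1,r))_∞ = 1`, `(Λ(1,r))_f ∈ U_f`.
HONEST LABEL.  Count-neutral helper; it retires nothing by itself: `HC_CM` is proved only modulo the 7 printed citations (2 remaining named inputs:
hLiu418 = `stmt-HodgeConjecture-24832`, h413 = `stmt-HodgeConjecture-24833`) until rung 0 closes.

## References
* [BorelJacquet1979] A. Borel, H. Jacquet, *Automorphic forms and automorphic representations*, PSPM 33.1 (1979), §1.1 (no small subgroups, `K`-finite vectors), §4.1 (`G(𝔸_f)`, levels).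
* [PlatonovRapinchuk1994] V. Platonov, A. Rapinchuk, *Algebraic Groups and Number Theory* (1994), §5.1 (`GL_n(𝔸_f) = ∏' GL_n(K_v)`, congruence subgroups).
* [NeukirchANT1999] J. Neukirch, *Algebraic Number Theory* (1999), VII §6 (6.11) (modules of definition of Hecke characters).
* [Tan1999] V. Tan, Canad. J. Math. 51 (1999), §1 p. 166 (standard sections, `K = K_∞ ∏ K_v`).
-/

set_option autoImplicit false
set_option linter.dupNamespace false -- the mandated namespace repeats `HodgeConjecture.HodgeConjecture`

noncomputable section

open scoped Matrix Topology
open NumberField IsDedekindDomain Set Filter ValuativeRel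
open Literature.NumberTheory.Automorphic Literature.NumberTheory.GaloisRepresentations
open Literature.NumberTheory.GelbartRogawski1991 Literature.NumberTheory.GelbartRogawski1991.GRConstruction
open Literature.NumberTheory.K2Lit.SiegelDoubled
open Summit.HodgeConjecture.HodgeConjecture.Cruxes.HLiu418.K2LiuIwasawaDatumStdSmooth (exists_isOpen_forall_mul_eq_of_isStd exists_openSubgroup_forall_eq_one
  continuous_of_mem_rightTranslateSpan)

namespace Summit.HodgeConjecture.HodgeConjecture.Cruxes.HLiu418.K2LiuSiegelMiddleTermLevelLetters

/-! ## §1 Principal congruence levels are a neighbourhood basis of `1` in `GL_n(𝔸_L^∞)`, read on `GL_n(𝒪̂_L)` -/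

section Level

variable {n : ℕ} {L : Type} [Field L] [NumberField L]

/-- **LEVELS ARE A NEIGHBOURHOOD BASIS OF `1`.**  Every neighbourhood `W` of `1` in `GL_n(𝔸_L^∞)` contains, for some finite set `S` of finite places and levels `γ_v` with
`0 ≠ γ_v < 1`, every `r ∈ GL_n(𝒪̂_L)` whose components `r_v`, `v ∈ S`, lie in the principal congruence subgroups `K_v(γ_v)` (★ `congruenceGL`).  (`GL_n(𝒪̂_L) ≃ₜ ∏_v GL_n(𝒪_v)`
by ★ `GLn.bijective_integralComponents` — a continuous bijection from a compact space to a Hausdorff one —, a product neighbourhood of `1` constrains finitely many places, and at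
those ★ `exists_congruenceGL_subset`.) [cite: PlatonovRapinchuk1994, §5.1] [cite: BorelJacquet1979, §4.1] -/
theorem exists_level_subset_of_mem_nhds_one {W : Set (GL (Fin n) (FiniteAdeleRing (𝓞 L) L))} (hW : W ∈ 𝓝 (1 : GL (Fin n) (FiniteAdeleRing (𝓞 L) L))) :
    ∃ (S : Finset (HeightOneSpectrum (𝓞 L))) (γl : ∀ v : HeightOneSpectrum (𝓞 L), ValueGroupWithZero (v.adicCompletion L)),
      (∀ v ∈ S, γl v ≠ 0) ∧ (∀ v ∈ S, γl v < 1) ∧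
      ∀ r : GL (Fin n) (FiniteAdeleRing (𝓞 L) L), r ∈ glFiniteIntegralLevel n L →
        (∀ v ∈ S, GLn.evalAt n L v r ∈ congruenceGL n (γl v)) → r ∈ W := by
  classical
  -- a nonzero level `< 1` at every place: the valuation of a uniformiser
  have hsmall : ∀ v : HeightOneSpectrum (𝓞 L), ∃ γ₁ : ValueGroupWithZero (v.adicCompletion L), γ₁ ≠ 0 ∧ γ₁ < 1 := by
    intro v
    have hle : ∀ a b : v.adicCompletion L,
        valuation (v.adicCompletion L) a ≤ valuation (v.adicCompletion L) b ↔ Valued.v a ≤ Valued.v b := fun a b =>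
      (Valuation.vle_iff_le (valuation (v.adicCompletion L))).symm.trans (Valuation.vle_iff_le Valued.v)
    refine ⟨valuation (v.adicCompletion L) (HeckeCharacter.uniformizer L v : v.adicCompletion L),
      (Valuation.ne_zero_iff _).2 (HeckeCharacter.uniformizer L v).ne_zero, ?_⟩
    rw [← (valuation (v.adicCompletion L)).map_one, lt_iff_not_ge, hle, not_le, map_one, HeckeCharacter.valued_uniformizer,
      ← WithZero.exp_zero, WithZero.exp_lt_exp]
    decide
  choose γ₁ hγ₁0 hγ₁1 using hsmall
  -- `GL_n(𝒪̂_L) ≃ₜ ∏_v GL_n(𝒪_v)`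
  haveI : T2Space (FiniteAdeleRing (𝓞 L) L) := inferInstanceAs <| T2Space <|
    RestrictedProduct (fun v : HeightOneSpectrum (𝓞 L) => v.adicCompletion L) (fun v => (v.adicCompletionIntegers L : Set (v.adicCompletion L))) cofinite
  haveI : CompactSpace (glFiniteIntegralLevel n L) := isCompact_iff_compactSpace.mp (isCompact_glFiniteIntegralLevel_holds n L)
  let ψ : glFiniteIntegralLevel n L ≃ₜ ((v : HeightOneSpectrum (𝓞 L)) → glInt n (v.adicCompletion L)) :=
    Continuous.homeoOfEquivCompactToT2 (f := Equiv.ofBijective _ (GLn.bijective_integralComponents (n := n) (K := L)))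
      (by exact GLn.continuous_integralComponents)
  have hψ : ∀ k, ψ k = GLn.integralComponents n L k := fun _ => rfl
  have hψ1 : ψ 1 = 1 := by
    funext v
    rw [hψ]
    refine Subtype.ext ?_
    show GLn.evalAt n L v ((1 : glFiniteIntegralLevel n L) : GL (Fin n) (FiniteAdeleRing (𝓞 L) L)) = 1
    rw [OneMemClass.coe_one, map_one]
  -- `W ∩ GL_n(𝒪̂_L)` in the subtype, transported to the product
  have hW' : Subtype.val ⁻¹' W ∈ 𝓝 (1 : glFiniteIntegralLevel n L) := continuous_subtype_val.continuousAt.preimage_mem_nhds (by exact hW)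
  have hW'' : ψ.symm ⁻¹' (Subtype.val ⁻¹' W) ∈ 𝓝 (1 : (v : HeightOneSpectrum (𝓞 L)) → glInt n (v.adicCompletion L)) := by
    rw [← hψ1]
    refine ψ.symm.continuous.continuousAt.preimage_mem_nhds ?_
    rw [ψ.symm_apply_apply]
    exact hW'
  rw [nhds_pi, Filter.mem_pi] at hW''
  obtain ⟨I, hI, t, ht, htW⟩ := hW''
  -- at each place, a principal congruence subgroup inside `t v`
  have hloc : ∀ v : HeightOneSpectrum (𝓞 L), ∃ γ : ValueGroupWithZero (v.adicCompletion L), γ ≠ 0 ∧ γ < 1 ∧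
      ∀ g : glInt n (v.adicCompletion L), (g : GL (Fin n) (v.adicCompletion L)) ∈ congruenceGL n γ → g ∈ t v := by
    intro v
    obtain ⟨u, hu, hut⟩ := (mem_nhds_subtype _ (1 : glInt n (v.adicCompletion L)) (t v)).1 (ht v)
    obtain ⟨γ, hγu⟩ := exists_congruenceGL_subset (n := n) hu
    refine ⟨min (γ : ValueGroupWithZero (v.adicCompletion L)) (γ₁ v), ?_, (min_le_right _ _).trans_lt (hγ₁1 v), fun g hg => hut (hγu ?_)⟩
    · rcases min_choice (γ : ValueGroupWithZero (v.adicCompletion L)) (γ₁ v) with h | h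
      · rw [h]; exact γ.ne_zero
      · rw [h]; exact hγ₁0 v
    · exact congruenceGL_mono (min_le_left _ _) hg
  choose γ hγ0 hγ1 hγt using hloc
  refine ⟨hI.toFinset, γ, fun v _ => hγ0 v, fun v _ => hγ1 v, fun r hr hrS => ?_⟩
  -- `ψ ⟨r, hr⟩` lies in the product neighbourhood
  have hmem : ψ ⟨r, hr⟩ ∈ I.pi t := by
    intro v hv
    rw [hψ]
    exact hγt v _ (hrS v (hI.mem_toFinset.2 hv))
  have key := htW hmem
  rw [Set.mem_preimage, ψ.symm_apply_apply] at key
  exact key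

end Level

/-! ## §2 The conductor of `χ ∘ det` on `GL_n(𝒪̂_L)` -/

section Conductor

variable {n : ℕ} {L : Type} [Field L] [NumberField L]

/-- **`χ(det (1, r)) = 1` NEAR `1`.**  For a Hecke character `χ` of `L` there is a neighbourhood `W` of `1` in `GL_n(𝔸_L^∞)` (inside `GL_n(𝒪̂_L)`) with
`χ(det(GLn.ofFinite r)) = 1` for `r ∈ W`: `r ↦ χ(det (1, r))` is a continuous homomorphism from the compact, Hausdorff, totally disconnected group `GL_n(𝒪̂_L)` to `ℂ`, so its
kernel is OPEN (no small subgroups in `ℂ`, ★ `exists_openSubgroup_forall_eq_one`), and `GL_n(𝒪̂_L)` is open in `GL_n(𝔸_L^∞)` (★ `isOpen_glFiniteIntegralLevel`) — the module of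
definition of `χ` read through `det`. [cite: NeukirchANT1999, VII §6 (6.11)] [cite: BorelJacquet1979, §1.1] -/
theorem exists_nhds_one_forall_heckeCharacter_det_eq_one (χ : HeckeCharacter L) :
    ∃ W ∈ 𝓝 (1 : GL (Fin n) (FiniteAdeleRing (𝓞 L) L)),
      ∀ r ∈ W, χ (Matrix.GeneralLinearGroup.det (GLn.ofFinite n L r)) = 1 := by
  haveI : T2Space (FiniteAdeleRing (𝓞 L) L) := inferInstanceAs <| T2Space <|
    RestrictedProduct (fun v : HeightOneSpectrum (𝓞 L) => v.adicCompletion L) (fun v => (v.adicCompletionIntegers L : Set (v.adicCompletion L))) cofinite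
  haveI : CompactSpace (glFiniteIntegralLevel n L) := isCompact_iff_compactSpace.mp (isCompact_glFiniteIntegralLevel_holds n L)
  haveI : TotallyDisconnectedSpace (GL (Fin n) (FiniteAdeleRing (𝓞 L) L)) := totallyDisconnectedSpace_GL_finiteAdeleRing L n
  haveI : TotallyDisconnectedSpace (glFiniteIntegralLevel n L) := Subtype.totallyDisconnectedSpace
  -- the continuous homomorphism `T r = χ(det (1, r))`
  obtain ⟨T, hT⟩ : ∃ T : glFiniteIntegralLevel n L → ℂ, ∀ k, T k =
      ((χ (Matrix.GeneralLinearGroup.det (GLn.ofFinite n L (k : GL (Fin n) (FiniteAdeleRing (𝓞 L) L)))) : ℂˣ) : ℂ) :=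
    ⟨fun k : glFiniteIntegralLevel n L =>
      ((χ (Matrix.GeneralLinearGroup.det (GLn.ofFinite n L (k : GL (Fin n) (FiniteAdeleRing (𝓞 L) L)))) : ℂˣ) : ℂ), fun _ => rfl⟩
  have hTfun : T = fun k : glFiniteIntegralLevel n L => ((χ (Matrix.GeneralLinearGroup.det (GLn.ofFinite n L (k : GL (Fin n) (FiniteAdeleRing (𝓞 L) L)))) : ℂˣ) : ℂ) := funext hT
  have hT1 : T 1 = 1 := by rw [hT, OneMemClass.coe_one, map_one, map_one, map_one, Units.val_one]
  have hTmul : ∀ u v, T (u * v) = T u * T v := fun u v => by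
    rw [hT, hT, hT, Subgroup.coe_mul, map_mul, map_mul, map_mul, Units.val_mul]
  have hTc : Continuous T := by
    rw [hTfun]
    exact Units.continuous_val.comp ((map_continuous χ).comp (Matrix.GeneralLinearGroup.continuous_det.comp
      ((GLn.continuous_ofFinite (n := n) (K := L)).comp continuous_subtype_val)))
  obtain ⟨H, hH⟩ := exists_openSubgroup_forall_eq_one T hT1 hTmul hTc
  refine ⟨Subtype.val '' (H : Set (glFiniteIntegralLevel n L)), ?_, ?_⟩
  · refine IsOpen.mem_nhds ((isOpen_glFiniteIntegralLevel n L).isOpenMap_subtype_val _ H.isOpen) ⟨1, H.one_mem, rfl⟩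
  · rintro _ ⟨k, hk, rfl⟩
    have h1 := hH k hk
    rw [hT] at h1
    exact Units.val_eq_one.1 h1

end Conductor

/-! ## §3 Lemma K-f for the whole `K`-type of `φ` -/

section KType

variable {L : Type} [Field L] [NumberField L] [IsCMField L]
variable {N M n : ℕ} {e : Fin N × Fin M ≃ Fin n}
  {dV : Fin N → L} {hdV : ∀ i, IsCMField.complexConj L (dV i) = dV i}
  {dW : Fin M → L} {hdW : ∀ i, IsCMField.complexConj L (dW i) = dW i}

/-- the span of the right `𝒦.K`-translates of `φ` is right-`𝒦.K`-stable. [folklore] -/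
theorem rightTranslate_mem_rightTranslateSpan_of_mem (𝒦 : IwasawaDatum L e dV hdV dW hdW) (φ : HA L e dV hdV dW hdW → ℂ)
    {ψ : HA L e dV hdV dW hdW → ℂ} (hψ : ψ ∈ rightTranslateSpan 𝒦 φ) {c : HA L e dV hdV dW hdW} (hc : c ∈ 𝒦.K) :
    (fun h => ψ (h * c)) ∈ rightTranslateSpan 𝒦 φ := by
  induction hψ using Submodule.span_induction with
  | mem x hx =>
    obtain ⟨k, rfl⟩ := hx
    refine Submodule.subset_span ⟨⟨c * (k : HA L e dV hdV dW hdW), 𝒦.K.mul_mem hc k.2⟩, funext fun h => ?_⟩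
    show φ (h * (c * (k : HA L e dV hdV dW hdW))) = φ (h * c * (k : HA L e dV hdV dW hdW))
    rw [mul_assoc]
  | zero => exact Submodule.zero_mem _
  | add x y _ _ hx hy => exact Submodule.add_mem _ hx hy
  | smul a x _ hx => exact Submodule.smul_mem _ a hx

/-- every vector of the span of the right translates of a `𝒦.K`-finite `φ` is `𝒦.K`-finite. [cite: BorelJacquet1979, §4.1] -/
theorem isKFinite_of_mem_rightTranslateSpan (𝒦 : IwasawaDatum L e dV hdV dW hdW) {φ : HA L e dV hdV dW hdW → ℂ} (hφ : Literature.NumberTheory.K2Lit.SiegelDoubled.IsKFinite 𝒦 φ)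
    {ψ : HA L e dV hdV dW hdW → ℂ} (hψ : ψ ∈ rightTranslateSpan 𝒦 φ) : Literature.NumberTheory.K2Lit.SiegelDoubled.IsKFinite 𝒦 ψ := by
  haveI : FiniteDimensional ℂ (rightTranslateSpan 𝒦 φ) := hφ
  show FiniteDimensional ℂ (rightTranslateSpan 𝒦 ψ)
  refine Submodule.finiteDimensional_of_le (S₁ := rightTranslateSpan 𝒦 ψ) (S₂ := rightTranslateSpan 𝒦 φ) (Submodule.span_le.2 ?_)
  rintro _ ⟨k, rfl⟩
  exact rightTranslate_mem_rightTranslateSpan_of_mem 𝒦 φ hψ k.2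

/-- **LEMMA K-f FOR THE WHOLE `K`-TYPE.**  For a STANDARD Iwasawa datum `𝒦` and a continuous `𝒦.K`-finite `φ`, there is ONE open subgroup `U_f ≤ H(𝔸_f)` such that EVERY `ψ` in
the span `V` of the right `𝒦.K`-translates of `φ` satisfies `ψ(h·k) = ψ(h)` for all `k` with trivial archimedean component and finite component in `U_f` (★ Lemma K-f
`exists_isOpen_forall_mul_eq_of_isStd` at each vector of a finite spanning set of the finite-dimensional `V` — each is continuous and `𝒦.K`-finite since `V` is right-`𝒦.K`-stable —,
intersected). [cite: BorelJacquet1979, §1.1, §4.1] [cite: Tan1999, §1 p. 166] -/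
theorem exists_isOpen_forall_rightTranslateSpan_mul_eq {𝒦 : IwasawaDatum L e dV hdV dW hdW} (h𝒦 : 𝒦.IsStd)
    {φ : HA L e dV hdV dW hdW → ℂ} (hφ : Literature.NumberTheory.K2Lit.SiegelDoubled.IsKFinite 𝒦 φ) (hφc : Continuous φ) :
    ∃ Uf : Subgroup (UnitaryGroup.finAdelic (Fp L) L (IsCMField.complexConj L) (n + n) (hermD L e dV hdV dW hdW)),
      IsOpen (Uf : Set (UnitaryGroup.finAdelic (Fp L) L (IsCMField.complexConj L) (n + n) (hermD L e dV hdV dW hdW))) ∧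
      ∀ ψ ∈ rightTranslateSpan 𝒦 φ, ∀ k : HA L e dV hdV dW hdW,
        UnitaryGroup.archPart (Fp L) L (IsCMField.complexConj L) (n + n) (hermD L e dV hdV dW hdW) k = 1 →
        UnitaryGroup.finPart (Fp L) L (IsCMField.complexConj L) (n + n) (hermD L e dV hdV dW hdW) k ∈ Uf →
        ∀ h : HA L e dV hdV dW hdW, ψ (h * k) = ψ h := by
  classical
  -- a finite spanning set `T` of `V`
  haveI hVfd : FiniteDimensional ℂ (rightTranslateSpan 𝒦 φ) := hφ
  obtain ⟨T, hT⟩ : (rightTranslateSpan 𝒦 φ).FG := (Submodule.fg_iff_finiteDimensional _).2 hVfd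
  have hTmem : ∀ t ∈ T, t ∈ rightTranslateSpan 𝒦 φ := fun t ht => hT ▸ Submodule.subset_span ht
  -- Lemma K-f at each `t ∈ T`
  have hKf : ∀ t : ↥T, ∃ U : Subgroup (UnitaryGroup.finAdelic (Fp L) L (IsCMField.complexConj L) (n + n) (hermD L e dV hdV dW hdW)),
      IsOpen (U : Set (UnitaryGroup.finAdelic (Fp L) L (IsCMField.complexConj L) (n + n) (hermD L e dV hdV dW hdW))) ∧
      ∀ k : HA L e dV hdV dW hdW,
        UnitaryGroup.archPart (Fp L) L (IsCMField.complexConj L) (n + n) (hermD L e dV hdV dW hdW) k = 1 →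
        UnitaryGroup.finPart (Fp L) L (IsCMField.complexConj L) (n + n) (hermD L e dV hdV dW hdW) k ∈ U →
        ∀ h : HA L e dV hdV dW hdW, (t : HA L e dV hdV dW hdW → ℂ) (h * k) = (t : HA L e dV hdV dW hdW → ℂ) h := fun t =>
    exists_isOpen_forall_mul_eq_of_isStd h𝒦 (isKFinite_of_mem_rightTranslateSpan 𝒦 hφ (hTmem t.1 t.2))
      (continuous_of_mem_rightTranslateSpan 𝒦 hφc (hTmem t.1 t.2))
  choose U hUo hUinv using hKf
  refine ⟨⨅ t : ↥T, U t, ?_, fun ψ hψ k hk1 hkU h => ?_⟩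
  · rw [Subgroup.coe_iInf]
    exact isOpen_iInter_of_finite fun t => hUo t
  · have hkU' : ∀ t : ↥T, UnitaryGroup.finPart (Fp L) L (IsCMField.complexConj L) (n + n) (hermD L e dV hdV dW hdW) k ∈ U t :=
      fun t => (Subgroup.mem_iInf.1 hkU) t
    rw [← hT] at hψ
    induction hψ using Submodule.span_induction generalizing h with
    | mem x hx => exact hUinv ⟨x, hx⟩ k hk1 (hkU' ⟨x, hx⟩) h
    | zero => rfl
    | add x y _ _ hx hy => rw [Pi.add_apply, Pi.add_apply, hx h, hy h]
    | smul a x _ hx => rw [Pi.smul_apply, Pi.smul_apply, hx h]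

end KType

/-! ## §4 THE LEVEL LETTERS of I4 ED. 4, PAID -/

section Main

variable {L : Type} [Field L] [NumberField L] [IsCMField L]
variable {N M n : ℕ} {e : Fin N × Fin M ≃ Fin n}
  {dV : Fin N → L} {hdV : ∀ i, IsCMField.complexConj L (dV i) = dV i}
  {dW : Fin M → L} {hdW : ∀ i, IsCMField.complexConj L (dW i) = dW i}

/-- **(u-0c) I4 ED. 4 — THE LEVEL LETTERS `S γl hγ0 hγ1 hχlev U hUK hfU hΛU`, PAID.**  For a STANDARD Iwasawa datum `𝒦` (`𝒦.IsStd`), a continuous `𝒦.K`-finite `φ : H(𝔸) → ℂ` (at the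
datum: `φ = f s₀`, `hφ = hstd.2.1 s₀`, `hφc = hcont s₀`), ANY Hecke character `χ` of `L` and ANY continuous homomorphism `Λ : GL_n(𝔸_L) →* H(𝔸)` with `(Λ(1, r))_∞ = 1` on `GL_n(𝔸_L^∞)`
(`hΛ1`; the chart's Levi homomorphism ★ `exists_leviHom`): there are ONE finite set `S` of finite places of `L` with levels `0 ≠ γ_v < 1` (`v ∈ S`) and ONE subgroup `U ≤ H(𝔸)` with
(`hχlev`) `χ(det(1, r)) = 1` for every `r ∈ GL_n(𝒪̂_L)` with `r_v ∈ K_v(γ_v)` (`v ∈ S`); (`hUK`) `k⁻¹ u k ∈ U` for `k ∈ 𝒦.K`, `u ∈ U`; (`hfU`) `φ(g·u) = φ(g)` for `u ∈ U`; (`hΛU`)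
`Λ(1, r) ∈ U` for every such `r`.  (`U := {u | ∀ c ∈ 𝒦.K, ∀ g, φ(g·c⁻¹uc) = φ(g)}`; the level = §1 applied to §2's neighbourhood ∩ `{r | (Λ(1,r))_f ∈ U_f}` for §3's `U_f`; `hΛU` because
`R_c φ ∈ V` is `U_f`-invariant.) [cite: BorelJacquet1979, §1.1, §4.1] [cite: Tan1999, §1 p. 166] [cite: NeukirchANT1999, VII §6 (6.11)] [cite: PlatonovRapinchuk1994, §5.1] -/
theorem exists_level_letters {𝒦 : IwasawaDatum L e dV hdV dW hdW} (h𝒦 : 𝒦.IsStd)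
    (φ : HA L e dV hdV dW hdW → ℂ) (hφ : Literature.NumberTheory.K2Lit.SiegelDoubled.IsKFinite 𝒦 φ) (hφc : Continuous φ) (χ : HeckeCharacter L)
    (Λ : GL (Fin n) (AdeleRing (𝓞 L) L) →* HA L e dV hdV dW hdW) (hΛc : Continuous Λ)
    (hΛ1 : ∀ r : GL (Fin n) (FiniteAdeleRing (𝓞 L) L),
      UnitaryGroup.archPart (Fp L) L (IsCMField.complexConj L) (n + n) (hermD L e dV hdV dW hdW) (Λ (GLn.ofFinite n L r)) = 1) :
    ∃ (S : Finset (HeightOneSpectrum (𝓞 L))) (γl : ∀ v : HeightOneSpectrum (𝓞 L), ValuativeRel.ValueGroupWithZero (v.adicCompletion L)),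
      (∀ v ∈ S, γl v ≠ 0) ∧ (∀ v ∈ S, γl v < 1) ∧
      (∀ r : GL (Fin n) (FiniteAdeleRing (𝓞 L) L), r ∈ glFiniteIntegralLevel n L → (∀ v ∈ S, GLn.evalAt n L v r ∈ congruenceGL n (γl v)) →
        χ (Matrix.GeneralLinearGroup.det (GLn.ofFinite n L r)) = 1) ∧
      ∃ U : Subgroup (HA L e dV hdV dW hdW),
        (∀ k ∈ 𝒦.K, ∀ u ∈ U, k⁻¹ * u * k ∈ U) ∧
        (∀ (g : HA L e dV hdV dW hdW), ∀ u ∈ U, φ (g * u) = φ g) ∧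
        ∀ r : GL (Fin n) (FiniteAdeleRing (𝓞 L) L), r ∈ glFiniteIntegralLevel n L → (∀ v ∈ S, GLn.evalAt n L v r ∈ congruenceGL n (γl v)) →
          Λ (GLn.ofFinite n L r) ∈ U := by
  -- §3: one open `U_f` fixing every vector of `V`
  obtain ⟨Uf, hUfo, hinv⟩ := exists_isOpen_forall_rightTranslateSpan_mul_eq (n := n) h𝒦 hφ hφc
  -- the open preimage `W₁ = {r | (Λ(1,r))_f ∈ U_f}` and §2's neighbourhood `W₂`
  have hW₁o : IsOpen {r : GL (Fin n) (FiniteAdeleRing (𝓞 L) L) |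
      UnitaryGroup.finPart (Fp L) L (IsCMField.complexConj L) (n + n) (hermD L e dV hdV dW hdW) (Λ (GLn.ofFinite n L r)) ∈ Uf} :=
    hUfo.preimage ((UnitaryGroup.continuous_finPart (Fp L) L (IsCMField.complexConj L) (n + n) (hermD L e dV hdV dW hdW)).comp
      (hΛc.comp (GLn.continuous_ofFinite (n := n) (K := L))))
  have hW₁1 : (1 : GL (Fin n) (FiniteAdeleRing (𝓞 L) L)) ∈ {r : GL (Fin n) (FiniteAdeleRing (𝓞 L) L) |
      UnitaryGroup.finPart (Fp L) L (IsCMField.complexConj L) (n + n) (hermD L e dV hdV dW hdW) (Λ (GLn.ofFinite n L r)) ∈ Uf} := by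
    have h1 : UnitaryGroup.finPart (Fp L) L (IsCMField.complexConj L) (n + n) (hermD L e dV hdV dW hdW) (1 : HA L e dV hdV dW hdW) = 1 := map_one _
    rw [Set.mem_setOf_eq, map_one, map_one, h1]
    exact Uf.one_mem
  obtain ⟨W₂, hW₂, hχW⟩ := exists_nhds_one_forall_heckeCharacter_det_eq_one (n := n) χ
  -- §1 on `W₁ ∩ W₂`
  obtain ⟨S, γl, hγ0, hγ1, hlev⟩ := exists_level_subset_of_mem_nhds_one (Filter.inter_mem (hW₁o.mem_nhds hW₁1) hW₂)
  refine ⟨S, γl, hγ0, hγ1, fun r hr hrS => hχW r (hlev r hr hrS).2,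
    { carrier := {u | ∀ c ∈ 𝒦.K, ∀ g : HA L e dV hdV dW hdW, φ (g * (c⁻¹ * u * c)) = φ g}
      mul_mem' := ?_
      one_mem' := ?_
      inv_mem' := ?_ }, ?_, ?_, ?_⟩
  · intro u u' hu hu' c hc g
    have key : g * (c⁻¹ * (u * u') * c) = g * (c⁻¹ * u * c) * (c⁻¹ * u' * c) := by group
    show φ (g * (c⁻¹ * (u * u') * c)) = φ g
    rw [key, hu' c hc, hu c hc]
  · intro c _ g
    show φ (g * (c⁻¹ * 1 * c)) = φ g
    rw [mul_one, inv_mul_cancel, mul_one]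
  · intro u hu c hc g
    have key : g * (c⁻¹ * u⁻¹ * c) * (c⁻¹ * u * c) = g := by group
    have h := hu c hc (g * (c⁻¹ * u⁻¹ * c))
    rw [key] at h
    show φ (g * (c⁻¹ * u⁻¹ * c)) = φ g
    exact h.symm
  · -- hUK
    intro k hk u hu c hc g
    have h := hu (k * c) (𝒦.K.mul_mem hk hc) g
    have key : g * (c⁻¹ * (k⁻¹ * u * k) * c) = g * ((k * c)⁻¹ * u * (k * c)) := by group
    show φ (g * (c⁻¹ * (k⁻¹ * u * k) * c)) = φ g
    rw [key, h]
  · -- hfU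
    intro g u hu
    have h := hu 1 𝒦.K.one_mem g
    rwa [inv_one, one_mul, mul_one] at h
  · -- hΛU
    intro r hr hrS c hc g
    have hfin := (hlev r hr hrS).1
    rw [Set.mem_setOf_eq] at hfin
    have hψ : (fun x => φ (x * c)) ∈ rightTranslateSpan 𝒦 φ := rightTranslate_mem_rightTranslateSpan 𝒦 φ hc
    have key := hinv _ hψ (Λ (GLn.ofFinite n L r)) (hΛ1 r) hfin (g * c⁻¹)
    rw [inv_mul_cancel_right] at key
    show φ (g * (c⁻¹ * Λ (GLn.ofFinite n L r) * c)) = φ g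
    rw [← key]
    congr 1
    group

end Main

end Summit.HodgeConjecture.HodgeConjecture.Cruxes.HLiu418.K2LiuSiegelMiddleTermLevelLetters

end
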